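import Literature.Probability.Process.BrownianPair
import Mathlib.Probability.Distributions.Gaussian.IsGaussianProcess.Independence
import HarnessLib

/-!
# The dyadic skeleton of Brownian motion: increments, piecewise-linear interpolation, bridges

Probability/Process support file (serves the provefact unit of
`Literature.MathematicalPhysics.KineticTheory.HeatConduction.CuneoEckmannHairerReyBellet2018_pinnedChain`,
second seat: absolute continuity of the transition probabilities of the Langevin-driven chain by a
finite-dimensional "partial Malliavin" argument, whose probabilistic core is the present file).
Everything here is PROVED; no named facts.

**Lévy's decomposition, read backwards.** Fix a level `m` and the dyadic nodes `t_i = i/2^m`,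
`i = 0, …, 2^m`, of `[0, 1]`. For a path `w` let `Δ^m w = (w(t_{i+1}) - w(t_i))_{i < 2^m}` be its
increments (the *skeleton*), `PL^m_x(u) = ∑_i x_i λ^m_i(u)` the piecewise-linear path with
increments `x` (`λ^m_i(u) = 2^m (min(t_{i+1},u) - min(t_i,u))`, the hat-function integrals), and
`R^m w = w - PL^m_{Δ^m w}` the *remainder* (for a Brownian path: the concatenation of the Brownian
bridges between consecutive nodes on `[0, 1]`, and `w(u) - (w(1) - w(0))` for `u ≥ 1`). Then, for a
pre-Brownian motion `B` (Mathlib's `IsPreBrownianReal`):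

* `IsPreBrownianReal.isGaussianProcess_dyadicIncr_bridgeRem` — skeleton and remainder are
  JOINTLY GAUSSIAN (finite linear combinations of values of `B`; Mathlib's
  `IsGaussianProcess.of_isGaussianProcess`);
* `IsPreBrownianReal.indepFun_dyadicIncr_bridgeRem` — **skeleton and remainder are
  INDEPENDENT** (as a random vector and a random path): uncorrelated,
  `Cov(B_{t_{i+1}} - B_{t_i}, R_u) = (min(t_{i+1},u) - min(t_i,u)) - λ^m_i(u)/2^m = 0`, and jointly
  Gaussian (Mathlib's `IsGaussianProcess.indepFun_of_covariance_eq_zero`);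

and for the canonical pair of independent Brownian motions of `BrownianPair.lean`
(`wienerPair`, `pairPath`):

* `pairSkel`, `pairRem`, `pairRecon` with `pairRecon m (pairSkel m ω) (pairRem m ω) = pairPath ω`
  (an identity) and measurability / continuity of all three;
* `indepFun_pairSkel_pairRem` — independence of the skeleton and the remainders of the pair;
* `map_pairSkel_absolutelyContinuous` — **the law of the skeleton is absolutely continuous with
  respect to Lebesgue measure** on `(Fin 2^m → ℝ)²` (independent increments with Gaussian laws
  `N(0, 2^{-m})`: Mathlib's `IsPreBrownianReal.hasIndepIncrements`, `hasLaw_sub`,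
  `iIndepFun.map_fun_eq_pi_map`, `gaussianReal_absolutelyContinuous`, and
  `absolutelyContinuous_pi_fin`, proved here: finite products of absolutely continuous measures
  are absolutely continuous);
* `lintegral_pairSkel_pairRem`, `measure_pairSkel_pairRem_eq_zero(_of_volume)` — the
  factorisation `E[G(Ξ, R)] = E[∫ G(x, R) dP_Ξ(x)]` and its null-set form: **an event which, for
  every remainder, is met only by a Lebesgue-null set of skeletons, is null.**

The last statement is the form in which the decomposition is consumed: conditionally on the
bridges, a functional of the Brownian pair becomes a function of finitely many independent
Gaussian coordinates, to which finite-dimensional calculus (submersions pull null sets back to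
null sets, `Literature/Analysis/Calculus/SubmersionNullPreimage.lean`) applies.

## References

* P. Lévy, *Processus stochastiques et mouvement brownien* (1948), Ch. I (the interpolation
  construction of Brownian motion); D. Revuz, M. Yor, *Continuous Martingales and Brownian Motion*
  (1999), Ch. I §1 (Gaussian characterisation; Brownian bridge). [folklore]

## Design choices

* Time horizon `[0, 1]` and dyadic nodes (nested in `m`, which consumers use for monotone
  approximation); paths are the raw paths `ℝ≥0 → ℝ` of `BrownianMotion.lean`, and all identities
  hold for every `u ≥ 0` (after time `1` all tent coefficients equal `1`, the interpolation is the
  constant `w(1) - w(0)` by telescoping, and `R(u) = w(u) - (w(1) - w(0))`), so no truncation of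
  paths is needed.
* `tentCoeff` is defined through `min` (not through a clamp), which makes the covariance
  computation a one-line consequence of `Cov(B_s, B_t) = min(s,t)`.
* The Gaussian statements are made for an arbitrary pre-Brownian motion on an arbitrary
  probability space (dot-notation extensions in Mathlib's namespace
  `ProbabilityTheory.IsPreBrownianReal`, as in `BrownianPair.lean`); the pair statements for the
  canonical `wienerPair`.
-/

noncomputable section

open MeasureTheory ProbabilityTheory Finset
open scoped NNReal ENNReal

namespace Literature.Probability.Process

open KolmogorovChentsov (dyad coe_dyad)

/-! ### Dyadic nodes, tent coefficients, increments, interpolation, remainder -/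

/- The dyadic nodes `t^m_i = i / 2^m` are the `KolmogorovChentsov.dyad m i : ℝ≥0` of
`KolmogorovChentsov.lean` (with `coe_dyad : (dyad m i : ℝ) = i / 2^m`). -/

/-- The dyadic nodes increase with the index. [folklore] -/
theorem dyad_mono (m : ℕ) : Monotone (dyad m) := fun i j h => by
  unfold KolmogorovChentsov.dyad
  gcongr

/-- `t_i ≤ t_j` for `i ≤ j`. [folklore] -/
theorem dyad_le_of_le (m : ℕ) {i j : ℕ} (h : i ≤ j) : dyad m i ≤ dyad m j :=
  dyad_mono m h

/-- Consecutive nodes are `2^{-m}` apart (real form of `KolmogorovChentsov.dist_dyad_succ`).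
[folklore] -/
theorem coe_dyad_succ_sub (m i : ℕ) : (dyad m (i + 1) : ℝ) - dyad m i = 1 / 2 ^ m := by
  rw [coe_dyad, coe_dyad]
  push_cast
  ring

/-- The tent coefficient `λ^m_i(u) = 2^m (min(t_{i+1}, u) - min(t_i, u))`: equal to `0` for
`u ≤ t_i`, to `1` for `u ≥ t_{i+1}`, and linear in between — the `i`-th hat-function integral of
the piecewise-linear interpolation at the dyadic nodes of level `m`. [folklore] -/
def tentCoeff (m i : ℕ) (u : ℝ≥0) : ℝ :=
  2 ^ m * ((min (dyad m (i + 1)) u : ℝ≥0) - (min (dyad m i) u : ℝ≥0) : ℝ)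

/-- The increments of a path over the dyadic intervals `[t_i, t_{i+1}]`, `i < 2^m`, of `[0, 1]`.
[folklore] -/
def dyadicIncr (m : ℕ) (w : ℝ≥0 → ℝ) : Fin (2 ^ m) → ℝ := fun i =>
  w (dyad m (i + 1)) - w (dyad m i)

/-- The piecewise-linear path with increments `x` over the dyadic intervals of level `m`:
`PL^m_x(u) = ∑_i x_i λ^m_i(u)` (`= 0` at `u = 0`, constant `∑ x_i` after time `1`). [folklore] -/
def plInterp (m : ℕ) (x : Fin (2 ^ m) → ℝ) (u : ℝ≥0) : ℝ := ∑ i, x i * tentCoeff m i u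

/-- The remainder `R^m w = w - PL^m_{Δ^m w}` of a path after subtracting the piecewise-linear
interpolation of its dyadic increments. For `u ≥ 1` it is `w(u) - (w(1) - w(0))`; on `[0, 1]`, when
`w 0 = 0` (true by construction for `brownian`, a.s. for a pre-Brownian motion), it is the
concatenation of the bridges `w - (linear interpolation of w between consecutive nodes)`.
[folklore] -/
def bridgeRem (m : ℕ) (w : ℝ≥0 → ℝ) (u : ℝ≥0) : ℝ := w u - plInterp m (dyadicIncr m w) u

/-- **The decomposition** `w = PL^m(Δ^m w) + R^m w` (an identity, by definition of the
remainder). [folklore] -/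
theorem plInterp_dyadicIncr_add_bridgeRem (m : ℕ) (w : ℝ≥0 → ℝ) (u : ℝ≥0) :
    plInterp m (dyadicIncr m w) u + bridgeRem m w u = w u := by
  unfold bridgeRem
  abel

/-- `PL^m_x` is linear in `x`. [folklore] -/
theorem plInterp_add (m : ℕ) (x y : Fin (2 ^ m) → ℝ) (u : ℝ≥0) :
    plInterp m (x + y) u = plInterp m x u + plInterp m y u := by
  simp [plInterp, add_mul, sum_add_distrib]

/-- `PL^m_{c x} = c PL^m_x`. [folklore] -/
theorem plInterp_smul (m : ℕ) (c : ℝ) (x : Fin (2 ^ m) → ℝ) (u : ℝ≥0) :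
    plInterp m (c • x) u = c * plInterp m x u := by
  simp [plInterp, mul_sum, mul_assoc]

/-- `u ↦ λ^m_i(u)` is continuous. [folklore] -/
@[fun_prop]
theorem continuous_tentCoeff (m i : ℕ) : Continuous (tentCoeff m i) := by
  unfold tentCoeff
  fun_prop

/-- `u ↦ PL^m_x(u)` is continuous. [folklore] -/
theorem continuous_plInterp (m : ℕ) (x : Fin (2 ^ m) → ℝ) : Continuous (plInterp m x) := by
  unfold plInterp
  fun_prop

/-- The remainder of a continuous path is continuous. [folklore] -/
theorem continuous_bridgeRem (m : ℕ) {w : ℝ≥0 → ℝ} (hw : Continuous w) :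
    Continuous (bridgeRem m w) :=
  hw.sub (continuous_plInterp m _)

/-- The covariance kernel identity behind the independence of skeleton and bridges:
`min(t_{i+1},t_{j+1}) - min(t_{i+1},t_j) - min(t_i,t_{j+1}) + min(t_i,t_j) = [i = j] / 2^m`.
[folklore] -/
theorem dyad_min_sub (m i j : ℕ) :
    ((min (dyad m (i + 1)) (dyad m (j + 1)) : ℝ≥0) : ℝ) -
        (min (dyad m (i + 1)) (dyad m j) : ℝ≥0) -
        (min (dyad m i) (dyad m (j + 1)) : ℝ≥0) +
        (min (dyad m i) (dyad m j) : ℝ≥0) =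
      if i = j then 1 / 2 ^ m else 0 := by
  rcases lt_trichotomy i j with hij | rfl | hij
  · -- `i + 1 ≤ j`
    rw [if_neg hij.ne, min_eq_left (dyad_le_of_le m (by omega : i + 1 ≤ j + 1)),
      min_eq_left (dyad_le_of_le m (by omega : i + 1 ≤ j)),
      min_eq_left (dyad_le_of_le m (by omega : i ≤ j + 1)),
      min_eq_left (dyad_le_of_le m hij.le)]
    ring
  · rw [if_pos rfl, min_self, min_eq_right (dyad_le_of_le m (Nat.le_succ i)),
      min_eq_left (dyad_le_of_le m (Nat.le_succ i)), min_self, ← coe_dyad_succ_sub m i]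
    ring
  · rw [if_neg hij.ne', min_eq_right (dyad_le_of_le m (by omega : j + 1 ≤ i + 1)),
      min_eq_right (dyad_le_of_le m (by omega : j ≤ i + 1)),
      min_eq_right (dyad_le_of_le m (by omega : j + 1 ≤ i)),
      min_eq_right (dyad_le_of_le m hij.le)]
    ring

/-! ### Absolute continuity of finite product measures -/

/-- A finite product of absolutely continuous measures is absolutely continuous with respect to
the product of the dominating measures (`Fin n`-indexed). [folklore] -/
theorem absolutelyContinuous_pi_fin {n : ℕ} {α : Fin n → Type*} [∀ i, MeasurableSpace (α i)]
    {μ ν : ∀ i, Measure (α i)} [∀ i, SigmaFinite (μ i)] [∀ i, SigmaFinite (ν i)]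
    (h : ∀ i, μ i ≪ ν i) : Measure.pi μ ≪ Measure.pi ν := by
  induction n with
  | zero =>
    rw [Measure.pi_of_empty μ, Measure.pi_of_empty ν]
  | succ n ih =>
    have hμ := (measurePreserving_piFinSuccAbove μ 0).symm
    have hν := (measurePreserving_piFinSuccAbove ν 0).symm
    rw [← hμ.map_eq, ← hν.map_eq]
    exact ((h 0).prod (ih fun i => h _)).map (MeasurableEquiv.measurable _)


/-! ### Skeleton and bridges of a pre-Brownian motion: joint Gaussianity and independence -/

section PreBrownian

variable {Ω : Type*} {mΩ : MeasurableSpace Ω} {P : Measure Ω} {B : ℝ≥0 → Ω → ℝ}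

/-- The dyadic increments and the bridge remainder of a pre-Brownian motion are JOINTLY GAUSSIAN
(each coordinate is a finite linear combination of values of `B`). Dot-notation extension declared
in Mathlib's namespace `ProbabilityTheory.IsPreBrownianReal`. [folklore] -/
theorem _root_.ProbabilityTheory.IsPreBrownianReal.isGaussianProcess_dyadicIncr_bridgeRem
    (hB : IsPreBrownianReal B P) (m : ℕ) :
    IsGaussianProcess (Sum.elim (fun (i : Fin (2 ^ m)) ω => dyadicIncr m (B · ω) i)
      (fun (u : ℝ≥0) ω => bridgeRem m (B · ω) u)) P := by
  classical
  refine hB.isGaussianProcess.of_isGaussianProcess fun s => ?_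
  cases s with
  | inl i =>
    refine ⟨{dyad m (i + 1), dyad m i},
      ContinuousLinearMap.proj (R := ℝ) (φ := fun _ : ({dyad m (i + 1), dyad m i} :
          Finset ℝ≥0) => ℝ) ⟨dyad m (i + 1), by simp⟩ -
        ContinuousLinearMap.proj (R := ℝ) ⟨dyad m i, by simp⟩, fun ω => ?_⟩
    simp [dyadicIncr]
  | inr u =>
    set I : Finset ℝ≥0 := insert u ((Finset.range (2 ^ m + 1)).image (dyad m)) with hI
    have hu : u ∈ I := by simp [hI]
    have hn : ∀ j : ℕ, j < 2 ^ m + 1 → dyad m j ∈ I := fun j hj => by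
      simp only [hI, Finset.mem_insert, Finset.mem_image, Finset.mem_range]
      exact Or.inr ⟨j, hj, rfl⟩
    refine ⟨I, ContinuousLinearMap.proj (R := ℝ) (φ := fun _ : I => ℝ) ⟨u, hu⟩ -
      ∑ j : Fin (2 ^ m), tentCoeff m j u •
        (ContinuousLinearMap.proj (R := ℝ) (φ := fun _ : I => ℝ)
            ⟨dyad m (j + 1), hn (j + 1) (by omega)⟩ -
          ContinuousLinearMap.proj (R := ℝ) (φ := fun _ : I => ℝ)
            ⟨dyad m j, hn j (by omega)⟩), fun ω => ?_⟩
    simp only [Sum.elim_inr, bridgeRem, plInterp, dyadicIncr, FunLike.coe_sub,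
      FunLike.coe_sum, FunLike.coe_smul, Pi.sub_apply, Finset.sum_apply,
      Pi.smul_apply, ContinuousLinearMap.proj_apply, smul_eq_mul, Finset.restrict_def]
    congr 1
    exact Finset.sum_congr rfl fun j _ => mul_comm _ _

/-- **The dyadic skeleton and the bridge remainder of a pre-Brownian motion are independent**
(as a random vector and a random path): they are jointly Gaussian and uncorrelated,
`Cov(B_{t_{i+1}} - B_{t_i}, B_u - PL(u)) = (min(t_{i+1},u) - min(t_i,u)) - λ_i(u)/2^m = 0`.
This is Lévy's construction of Brownian motion read backwards (skeleton plus independent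
bridges). Dot-notation extension declared in Mathlib's namespace
`ProbabilityTheory.IsPreBrownianReal`. [folklore] -/
theorem _root_.ProbabilityTheory.IsPreBrownianReal.indepFun_dyadicIncr_bridgeRem
    (hB : IsPreBrownianReal B P) (m : ℕ) :
    IndepFun (fun ω (i : Fin (2 ^ m)) => dyadicIncr m (B · ω) i)
      (fun ω (u : ℝ≥0) => bridgeRem m (B · ω) u) P := by
  have hP := hB.isGaussianProcess.isProbabilityMeasure
  have hL2 : ∀ t, MemLp (fun ω => B t ω) 2 P := fun t =>
    (hB.isGaussianProcess.hasGaussianLaw_eval t).memLp_two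
  have hcov : ∀ s t, cov[fun ω => B s ω, fun ω => B t ω; P] = ((min s t : ℝ≥0) : ℝ) :=
    fun s t => hB.covariance_fun_eval s t
  refine (hB.isGaussianProcess_dyadicIncr_bridgeRem m).indepFun_of_covariance_eq_zero
    (fun i => ?_) (fun u => ?_) fun i u => ?_
  · exact (hB.aemeasurable _).sub (hB.aemeasurable _)
  · unfold bridgeRem plInterp dyadicIncr
    exact (hB.aemeasurable u).sub (Finset.aemeasurable_fun_sum _ fun j _ =>
      ((hB.aemeasurable _).sub (hB.aemeasurable _)).mul_const _)
  -- the covariance computation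
  set a : ℕ → ℝ≥0 := fun j => dyad m (j + 1) with ha
  set b : ℕ → ℝ≥0 := fun j => dyad m j with hb
  have hΔ : ∀ j : ℕ, MemLp (fun ω => B (a j) ω - B (b j) ω) 2 P := fun j => (hL2 _).sub (hL2 _)
  have hS : ∀ j : Fin (2 ^ m), MemLp (fun ω => (B (a j) ω - B (b j) ω) * tentCoeff m j u) 2 P :=
    fun j => (hΔ j).mul_const _
  have hsum : MemLp (fun ω => ∑ j : Fin (2 ^ m), (B (a j) ω - B (b j) ω) * tentCoeff m j u) 2 P :=
    memLp_finsetSum _ fun j _ => hS j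
  change cov[fun ω => B (a i) ω - B (b i) ω,
    fun ω => B u ω - ∑ j : Fin (2 ^ m), (B (a j) ω - B (b j) ω) * tentCoeff m j u; P] = 0
  rw [covariance_fun_sub_right (hΔ i) (hL2 u) hsum, covariance_fun_sub_left (hL2 _) (hL2 _) (hL2 u),
    hcov, hcov, covariance_fun_sum_right (fun j => hS j) (hΔ i)]
  have hterm : ∀ j : Fin (2 ^ m),
      cov[fun ω => B (a i) ω - B (b i) ω, fun ω => (B (a j) ω - B (b j) ω) * tentCoeff m j u; P] =
        (if (i : ℕ) = j then 1 / 2 ^ m else 0) * tentCoeff m j u := by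
    intro j
    rw [covariance_mul_const_right, covariance_fun_sub_fun_sub (hL2 _) (hL2 _) (hL2 _) (hL2 _),
      hcov, hcov, hcov, hcov, ← dyad_min_sub m i j]
  simp_rw [hterm]
  have hsel : ∑ j : Fin (2 ^ m), (if (i : ℕ) = j then 1 / 2 ^ m else 0) * tentCoeff m j u =
      1 / 2 ^ m * tentCoeff m i u := by
    rw [Finset.sum_eq_single i]
    · simp
    · intro j _ hj
      rw [if_neg (fun h => hj (Fin.ext h).symm), zero_mul]
    · simp
  rw [hsel]
  unfold tentCoeff
  field_simp
  ring

end PreBrownian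

/-! ### The canonical Brownian pair: skeleton, bridges, reconstruction, factorisation of the law -/

section Pair

open Literature.Probability.RandomPlanarGeometry (isPreBrownianReal_brownian
  isProbabilityMeasure_preWienerMeasure')

variable (m : ℕ)

/-- The space of skeletons of the pair: the dyadic increments of level `m` of both paths.
[folklore] -/
abbrev PairSkeleton (m : ℕ) : Type := (Fin (2 ^ m) → ℝ) × (Fin (2 ^ m) → ℝ)

/-- The skeleton (dyadic increments of level `m` on `[0,1]`) of the pair of Brownian paths.
[folklore] -/
def pairSkel (ω : WienerPair) : PairSkeleton m :=
  (dyadicIncr m (pairPath ω).1, dyadicIncr m (pairPath ω).2)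

/-- The bridge remainders of the pair of Brownian paths. [folklore] -/
def pairRem (ω : WienerPair) : WienerPair :=
  (bridgeRem m (pairPath ω).1, bridgeRem m (pairPath ω).2)

/-- Reconstruction of a pair of paths from a skeleton and a pair of remainders:
`(PL^m_{x₁} + r₁, PL^m_{x₂} + r₂)`. [folklore] -/
def pairRecon (x : PairSkeleton m) (r : WienerPair) : WienerPair :=
  (fun u => plInterp m x.1 u + r.1 u, fun u => plInterp m x.2 u + r.2 u)

/-- **The pair of Brownian paths is reconstructed from its skeleton and its remainders.**
[folklore] -/
theorem pairRecon_pairSkel_pairRem (ω : WienerPair) :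
    pairRecon m (pairSkel m ω) (pairRem m ω) = pairPath ω := by
  ext u
  · exact plInterp_dyadicIncr_add_bridgeRem m _ u
  · exact plInterp_dyadicIncr_add_bridgeRem m _ u

/-- The single-path skeleton map. [folklore] -/
theorem pairSkel_eq_prodMap :
    pairSkel m = Prod.map (fun (ω₁ : ℝ≥0 → ℝ) => dyadicIncr m fun u => brownian u ω₁)
      (fun (ω₂ : ℝ≥0 → ℝ) => dyadicIncr m fun u => brownian u ω₂) := rfl

/-- The single-path remainder map. [folklore] -/
theorem pairRem_eq_prodMap :
    pairRem m = Prod.map (fun (ω₁ : ℝ≥0 → ℝ) => bridgeRem m fun u => brownian u ω₁)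
      (fun (ω₂ : ℝ≥0 → ℝ) => bridgeRem m fun u => brownian u ω₂) := rfl

/-- The skeleton of the canonical Brownian path is measurable. [folklore] -/
theorem measurable_dyadicIncr_brownian :
    Measurable fun (ω₁ : ℝ≥0 → ℝ) => dyadicIncr m fun u => brownian u ω₁ := by
  refine measurable_pi_iff.2 fun i => ?_
  unfold dyadicIncr
  exact (measurable_brownian _).sub (measurable_brownian _)

/-- The remainder of the canonical Brownian path is measurable (product σ-algebra). [folklore] -/
theorem measurable_bridgeRem_brownian :
    Measurable fun (ω₁ : ℝ≥0 → ℝ) => bridgeRem m fun u => brownian u ω₁ := by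
  refine measurable_pi_iff.2 fun u => ?_
  unfold bridgeRem plInterp dyadicIncr
  have h := fun t => measurable_brownian t
  fun_prop

/-- The skeleton is a measurable function of the pair. [folklore] -/
@[fun_prop]
theorem measurable_pairSkel : Measurable (pairSkel m) := by
  rw [pairSkel_eq_prodMap]
  exact (measurable_dyadicIncr_brownian m).prodMap (measurable_dyadicIncr_brownian m)

/-- The remainder is a measurable function of the pair. [folklore] -/
@[fun_prop]
theorem measurable_pairRem : Measurable (pairRem m) := by
  rw [pairRem_eq_prodMap]
  exact (measurable_bridgeRem_brownian m).prodMap (measurable_bridgeRem_brownian m)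

/-- The remainders are continuous paths. [folklore] -/
theorem continuous_pairRem_fst (ω : WienerPair) : Continuous (pairRem m ω).1 :=
  continuous_bridgeRem m (continuous_pairPath_fst ω)

/-- The second remainder is a continuous path. [folklore] -/
theorem continuous_pairRem_snd (ω : WienerPair) : Continuous (pairRem m ω).2 :=
  continuous_bridgeRem m (continuous_pairPath_snd ω)

/-- The reconstruction is jointly measurable. [folklore] -/
@[fun_prop]
theorem measurable_pairRecon : Measurable fun p : PairSkeleton m × WienerPair => pairRecon m p.1 p.2 := by
  unfold pairRecon plInterp
  refine (measurable_pi_iff.2 fun u => ?_).prodMk (measurable_pi_iff.2 fun u => ?_)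
  · have h1 : Measurable fun p : PairSkeleton m × WienerPair => p.2.1 u :=
      (measurable_pi_apply u).comp (measurable_fst.comp measurable_snd)
    have h2 : ∀ i : Fin (2 ^ m), Measurable fun p : PairSkeleton m × WienerPair => p.1.1 i :=
      fun i => (measurable_pi_apply i).comp (measurable_fst.comp measurable_fst)
    fun_prop
  · have h1 : Measurable fun p : PairSkeleton m × WienerPair => p.2.2 u :=
      (measurable_pi_apply u).comp (measurable_snd.comp measurable_snd)
    have h2 : ∀ i : Fin (2 ^ m), Measurable fun p : PairSkeleton m × WienerPair => p.1.2 i :=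
      fun i => (measurable_pi_apply i).comp (measurable_snd.comp measurable_fst)
    fun_prop

/-- For each remainder, the reconstruction is a continuous (affine) function of the skeleton,
coordinatewise. [folklore] -/
theorem continuous_pairRecon_apply_fst (r : WienerPair) (u : ℝ≥0) :
    Continuous fun x : PairSkeleton m => (pairRecon m x r).1 u := by
  unfold pairRecon plInterp
  fun_prop

/-- Second coordinate of the reconstruction: continuous in the skeleton. [folklore] -/
theorem continuous_pairRecon_apply_snd (r : WienerPair) (u : ℝ≥0) :
    Continuous fun x : PairSkeleton m => (pairRecon m x r).2 u := by
  unfold pairRecon plInterp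
  fun_prop

/-- **Skeleton and remainders of the Brownian pair are independent.** [folklore] -/
theorem indepFun_pairSkel_pairRem : IndepFun (pairSkel m) (pairRem m) wienerPair := by
  haveI := isProbabilityMeasure_preWienerMeasure'
  have h1 := isPreBrownianReal_brownian.indepFun_dyadicIncr_bridgeRem m
  rw [pairSkel_eq_prodMap, pairRem_eq_prodMap, wienerPair]
  exact indepFun_prodMap h1 h1 (measurable_dyadicIncr_brownian m) (measurable_bridgeRem_brownian m)
    (measurable_dyadicIncr_brownian m) (measurable_bridgeRem_brownian m)

/-- The law of the single-path skeleton is the product of the Gaussian laws of the increments,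
and is absolutely continuous with respect to Lebesgue measure. [folklore] -/
theorem map_dyadicIncr_brownian_absolutelyContinuous :
    preWienerMeasure.map (fun (ω₁ : ℝ≥0 → ℝ) => dyadicIncr m fun u => brownian u ω₁) ≪ volume := by
  haveI := isProbabilityMeasure_preWienerMeasure'
  have hB := isPreBrownianReal_brownian
  -- independence of the increments over the monotone family of nodes
  have hind : iIndepFun (fun (i : Fin (2 ^ m)) (ω₁ : ℝ≥0 → ℝ) =>
      brownian (dyad m (i + 1)) ω₁ - brownian (dyad m i) ω₁) preWienerMeasure := by
    have h := hB.hasIndepIncrements (2 ^ m) (fun j : Fin (2 ^ m + 1) => dyad m j)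
      (fun j k hjk => dyad_mono m (by exact_mod_cast hjk))
    convert h using 3
    simp
  have hmeas : ∀ i : Fin (2 ^ m), AEMeasurable (fun (ω₁ : ℝ≥0 → ℝ) =>
      brownian (dyad m (i + 1)) ω₁ - brownian (dyad m i) ω₁) preWienerMeasure :=
    fun i => ((measurable_brownian _).sub (measurable_brownian _)).aemeasurable
  have hpi := hind.map_fun_eq_pi_map hmeas
  change preWienerMeasure.map (fun (ω₁ : ℝ≥0 → ℝ) (i : Fin (2 ^ m)) =>
      brownian (dyad m (i + 1)) ω₁ - brownian (dyad m i) ω₁) ≪ volume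
  rw [hpi, volume_pi]
  refine absolutelyContinuous_pi_fin fun i => ?_
  have hlaw := (hB.hasLaw_sub (dyad m (i + 1)) (dyad m i)).map_eq
  have hfun : (brownian (dyad m (i + 1)) - brownian (dyad m i)) =
      fun (ω₁ : ℝ≥0 → ℝ) => brownian (dyad m (i + 1)) ω₁ - brownian (dyad m i) ω₁ := rfl
  rw [hfun] at hlaw
  rw [hlaw]
  refine gaussianReal_absolutelyContinuous 0 ?_
  have hne : (dyad m (i + 1) : ℝ) ≠ dyad m i := by
    intro h
    have := coe_dyad_succ_sub m i
    rw [h, sub_self] at this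
    exact absurd this (by positivity)
  exact fun h0 => hne (by simpa using nndist_eq_zero.1 h0)

/-- **The law of the skeleton of the pair is absolutely continuous** with respect to Lebesgue
measure on `(Fin 2^m → ℝ) × (Fin 2^m → ℝ)` (a product of centred Gaussians of variance `2^{-m}`).
[folklore] -/
theorem map_pairSkel_absolutelyContinuous : wienerPair.map (pairSkel m) ≪ volume := by
  haveI := isProbabilityMeasure_preWienerMeasure'
  rw [pairSkel_eq_prodMap, wienerPair, ← Measure.map_prod_map _ _
    (measurable_dyadicIncr_brownian m) (measurable_dyadicIncr_brownian m), Measure.volume_eq_prod]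
  exact (map_dyadicIncr_brownian_absolutelyContinuous m).prod
    (map_dyadicIncr_brownian_absolutelyContinuous m)

/-- **Factorisation of expectations over the skeleton.** For a nonnegative jointly measurable
`G` of (skeleton, remainder): `E[G(Ξ, R)] = E[ ω ↦ ∫ G(x, R ω) dP_Ξ(x) ]` — independence of
`Ξ = pairSkel` and `R = pairRem`. [folklore] -/
theorem lintegral_pairSkel_pairRem {G : PairSkeleton m × WienerPair → ℝ≥0∞} (hG : Measurable G) :
    ∫⁻ ω, G (pairSkel m ω, pairRem m ω) ∂wienerPair =
      ∫⁻ ω, ∫⁻ x, G (x, pairRem m ω) ∂(wienerPair.map (pairSkel m)) ∂wienerPair := by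
  have hind := indepFun_pairSkel_pairRem m
  have hlaw : wienerPair.map (fun ω => (pairSkel m ω, pairRem m ω)) =
      (wienerPair.map (pairSkel m)).prod (wienerPair.map (pairRem m)) :=
    (indepFun_iff_map_prod_eq_prod_map_map (measurable_pairSkel m).aemeasurable
      (measurable_pairRem m).aemeasurable).1 hind
  calc ∫⁻ ω, G (pairSkel m ω, pairRem m ω) ∂wienerPair
      = ∫⁻ p, G p ∂(wienerPair.map fun ω => (pairSkel m ω, pairRem m ω)) := by
        rw [lintegral_map hG ((measurable_pairSkel m).prodMk (measurable_pairRem m))]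
    _ = ∫⁻ p, G p ∂((wienerPair.map (pairSkel m)).prod (wienerPair.map (pairRem m))) := by rw [hlaw]
    _ = ∫⁻ r, ∫⁻ x, G (x, r) ∂(wienerPair.map (pairSkel m)) ∂(wienerPair.map (pairRem m)) :=
        lintegral_prod_symm _ hG.aemeasurable
    _ = ∫⁻ ω, ∫⁻ x, G (x, pairRem m ω) ∂(wienerPair.map (pairSkel m)) ∂wienerPair := by
        rw [lintegral_map ?_ (measurable_pairRem m)]
        exact hG.lintegral_prod_left'

/-- **Null sets through the skeleton**: if for (almost) every remainder `r` the set of skeletons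
`x` with `(x, r) ∈ S` is `P_Ξ`-null — in particular if it is Lebesgue-null
(`map_pairSkel_absolutelyContinuous`) — then `{ω : (Ξ ω, R ω) ∈ S}` is `wienerPair`-null.
[folklore] -/
theorem measure_pairSkel_pairRem_eq_zero {S : Set (PairSkeleton m × WienerPair)}
    (hS : MeasurableSet S)
    (h : ∀ᵐ ω ∂wienerPair, wienerPair.map (pairSkel m) {x | (x, pairRem m ω) ∈ S} = 0) :
    wienerPair {ω | (pairSkel m ω, pairRem m ω) ∈ S} = 0 := by
  have hind := indepFun_pairSkel_pairRem m
  have hlaw : wienerPair.map (fun ω => (pairSkel m ω, pairRem m ω)) =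
      (wienerPair.map (pairSkel m)).prod (wienerPair.map (pairRem m)) :=
    (indepFun_iff_map_prod_eq_prod_map_map (measurable_pairSkel m).aemeasurable
      (measurable_pairRem m).aemeasurable).1 hind
  have h1 : wienerPair {ω | (pairSkel m ω, pairRem m ω) ∈ S} =
      (wienerPair.map fun ω => (pairSkel m ω, pairRem m ω)) S := by
    rw [Measure.map_apply ((measurable_pairSkel m).prodMk (measurable_pairRem m)) hS]
    rfl
  rw [h1, hlaw, Measure.prod_apply_symm hS, lintegral_map (measurable_measure_prodMk_right hS)
    (measurable_pairRem m)]
  refine (lintegral_eq_zero_iff ((measurable_measure_prodMk_right hS).comp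
    (measurable_pairRem m))).2 ?_
  filter_upwards [h] with ω hω
  exact hω

/-- In particular: if for every pair of remainder paths `r` the skeleton section of `S` is
Lebesgue-null, then `{ω : (Ξ ω, R ω) ∈ S}` is null. [folklore] -/
theorem measure_pairSkel_pairRem_eq_zero_of_volume {S : Set (PairSkeleton m × WienerPair)}
    (hS : MeasurableSet S) (h : ∀ r : WienerPair, volume {x : PairSkeleton m | (x, r) ∈ S} = 0) :
    wienerPair {ω | (pairSkel m ω, pairRem m ω) ∈ S} = 0 :=
  measure_pairSkel_pairRem_eq_zero m hS (Filter.Eventually.of_forall fun ω =>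
    map_pairSkel_absolutelyContinuous m (h (pairRem m ω)))

end Pair

end Literature.Probability.Process
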